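import Mathlib.Algebra.Order.Ring.Int
import Mathlib.Algebra.Group.Int.Even
import Mathlib.Tactic.Ring
import Mathlib.Tactic.Linarith
import Mathlib.Tactic.LinearCombination
import Mathlib.Tactic.Positivity
import HarnessLib

/-!
# Venture HSemireg — doubly-even targets are never reached, by the `δ`-FREE route: the `35-A′` parametrisation,
# Cauchy–Schwarz + AM–GM integrality of the cross term, and parity (ENGINE-W code B, ask C24 ∕ PROBE5 §54 THEOREM 54)

HONEST FRAMING. Lean index of the computation cell `pub-hsemireg`, widening group ENGINE-W (code B = the independent second
code, seat `engine-w-2`, gen 10). POLYNOMIAL IDENTITIES IN A COMMUTATIVE RING AND INTEGER INEQUALITIES ∕ PARITY ONLY; the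
hermitian form `H`, its adjoint `G = adj H`, the lattice parametrisation and «reached» enter BY VALUE (docstrings). No abelian
variety, sheaf, `Ext` group or semiregularity map is constructed; nothing here says that HC, HC_CM or HC_AV holds. Theorems
only (0 `def`, 0 named fact, 0 `sorry`). This is the SECOND KERNEL ROUTE to THEOREM 54: the first (code A,
`DoublyEvenTargetObstruction.lean`, LEMMA 54.1) splits the norm into a rational part and a `δ = √(−3m)`-part and uses the
irrationality of `δ`; the route below never leaves `ℤ` — no `δ`, no irrationality — and is the derivation of record of
code B (`widen/ENGINE-W/out/hermite/sec44-B/SEC44-54-CODEB-CARD.md` §4 «THEOREM 54 in the 35-A′ variables (δ-free)»,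
TABLE-ENGINE-W row 456; machine legs `codeB/c24_B.py`, `c24_identity_check_B.py`: 0 exceptions on PRE-REG #13's 72 cells,
120 fresh doubly-even cells and all norm-one pairs of 494 reached cells, 168 of them with non-real `H`).

SETTING (by value, as printed in the card). `K = ℚ(ω)`, `ω² + ω + 1 = 0`, `O_K = ℤ[ω]`; `H = [[a, b],[b̄, e]]` ANY positive
hermitian binary form over `O_K` (`a, e ∈ ℤ`, `b ∈ O_K`), `d = det H = ae − b b̄ > 0`, `G = adj H = [[e, −b],[−b̄, a]]`
(so `HG = GH = d·1`, `G` hermitian); `H[x] := x*Hx = x̄₁(a x₁ + b x₂) + x̄₂(b̄ x₁ + e x₂) ∈ ℤ_{≥0}`, `H(x, y) := x*Hy`. Node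
field `ℚ(√m)`, `m < 0`, `M := |m| ≥ 1`; a TARGET is `(t, N′, A)` with **`A² + M = t·N′·d`**, `t, d > 0`. THE `35-A′`
PARAMETRISATION (code B `shortpair2_B.count_n`): pairs `(z, w) ∈ O_K² × O_K²`, `z₀ := A·z + t·G·w`, and the norm of the
lattice vector attached to `(z, w)` is **`Q(z, w) := (H[z₀] + M·H[z]) ∕ (t d)`**; the target is REACHED iff `Q(z, w) = 1` for
some pair. Write `S := z*w = z̄₁w₁ + z̄₂w₂ = p + qω ∈ O_K` (`p, q ∈ ℤ`), so `Tr S = S + S̄ = 2p − q` and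
`S̄ = (p − q) − qω`. THE ARGUMENT (card §4): (1) `H[z₀] = A²·H[z] + t²d·G[w] + tAd·Tr S` (from `HG = d·1`), hence with
`A² + M = tN′d`: `Q = N′·H[z] + t·G[w] + A·Tr S`; (2) `X := H(z₀, z) = A·H[z] + td·S̄ = u + vω` with `u = A·H[z] + td(p − q)`,
`v = −tdq`; Cauchy–Schwarz `X X̄ = u² − uv + v² ≤ H[z₀]·H[z]` and AM–GM on `H[z₀] + M·H[z] = td` give
`3(tdq)² ≤ 4 X X̄ ≤ 4 H[z₀]H[z] ≤ (td)²`, so `q = 0`: **for every norm-one pair `z*w ∈ ℤ`** (this is SEC35 §1's «`b = 0`»);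
(3) if `t` and `N′` are both even then `Q = N′H[z] + tG[w] + 2Ap` is even, so `Q = 1` is impossible: NEVER. ∎
What the kernel holds:

* §1 (any commutative ring; the conjugates `z̄ᵢ, w̄ᵢ, b̄` are carried as independent variables `zbᵢ, wbᵢ, bb`, so each
  statement is a polynomial identity that specialises to `O_K` with `x̄ = star x`): **`form_at_z0`** — identity (1);
  **`cross_term`** ∕ `cross_term'` — identity (2) for `H(z₀, z)` and `H(z, z₀)`; **`gram_identity`** — the binary Gram ∕
  Lagrange identity `H[z]·H[z₀] − H(z₀,z)·H(z,z₀) = d·(z₁z₀₂ − z₂z₀₁)·(its conjugate)` (the source of Cauchy–Schwarz when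
  `d > 0`); `formQ_of_target` — `H[z₀] + M·H[z] = td·(N′H[z] + tG[w] + A·Tr S)` under `A² + M = tN′d`.
* §2 (integers; the completion `4(u² − uv + v²) = (2u − v)² + 3v²` is used inline — as a theorem it is already in the tree,
  `HodgeLocusCensusDepth12At3.eisenstein_norm_four`): `am_gm_target` — `4·M·R·P ≤ (R + M·P)²`;
  **`normOne_forces_q_zero`** — from `M ≥ 1`, `R, P ≥ 0`, `td ≠ 0`, Cauchy–Schwarz by value
  `u² − uv + v² ≤ R·P` (`u = AP + td(p − q)`, `v = −tdq`) and the norm-one equation `R + M·P = td`: `q = 0`.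
* §3 **`doublyEven_never_deltaFree`** — THEOREM 54 assembled: with `R = H[z₀]` given by identity (1), the target relation,
  the by-value inequalities of §2 and `t`, `N′` even, `N′·P + t·Gw + A·(2p − q) ≠ 1`; `doublyEven_Q_even` — the parity
  statement on its own (`q = 0 ⇒ Q` even); `parity_hypotheses_needed` — neither parity hypothesis can be dropped.
WHAT IS NOT HERE: the model facts (that `Q` IS the norm of the lattice vector of the pair `(z, w)` and that every lattice
vector arises so — THEOREM 35-A′; positivity `H[x] ≥ 0`; `X X̄ ≥ 0`-type facts of `O_K ⊂ ℂ` beyond the displayed algebra),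
the converse data (mixed parity IS reached, PROBE5 §54 v6.2), and code A's `δ`-route. Tier of the source: hand ×2 across
codes (code A LEMMA 54.1 ∕ code B C24) + machine ×2.
-/

namespace Summit.Ventures.HSemireg.PairBlockDeltaFree

/-! ## §1 Polynomial identities of the `35-A′` parametrisation (any commutative ring; conjugates as independent variables) -/

/-- **Identity (1): the form at `z₀ = A·z + t·G·w`.** With `H = [[a, b],[bb, e]]`, `d = ae − b·bb`, `G = adj H =
[[e, −b],[−bb, a]]`, `z₀ = A z + t G w` and its conjugate `z̄₀ = A z̄ + t Ḡ w̄` (entries of `Ḡ`: `e, −bb ; −b, a`):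
`H[z₀] = A²·H[z] + t²·d·G[w] + t·A·d·(S + S̄)`, `S = z̄₁w₁ + z̄₂w₂`, `S̄ = z₁w̄₁ + z₂w̄₂`. Specialise `zbᵢ = z̄ᵢ`, `wbᵢ = w̄ᵢ`,
`bb = b̄` in `O_K`. [kernel, `ring`] -/
theorem form_at_z0 {R : Type*} [CommRing R] (a e b bb A t z₁ z₂ zb₁ zb₂ w₁ w₂ wb₁ wb₂ : R) :
    (A * zb₁ + t * (e * wb₁ - bb * wb₂)) * (a * (A * z₁ + t * (e * w₁ - b * w₂)) + b * (A * z₂ + t * (-bb * w₁ + a * w₂)))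
      + (A * zb₂ + t * (-b * wb₁ + a * wb₂)) *
          (bb * (A * z₁ + t * (e * w₁ - b * w₂)) + e * (A * z₂ + t * (-bb * w₁ + a * w₂)))
    = A ^ 2 * (zb₁ * (a * z₁ + b * z₂) + zb₂ * (bb * z₁ + e * z₂))
      + t ^ 2 * (a * e - b * bb) * (wb₁ * (e * w₁ - b * w₂) + wb₂ * (-bb * w₁ + a * w₂))
      + t * A * (a * e - b * bb) * ((zb₁ * w₁ + zb₂ * w₂) + (z₁ * wb₁ + z₂ * wb₂)) := by
  ring

/-- **Identity (2): the cross term** `H(z₀, z) = z̄₀ᵀ·H·z = A·H[z] + t·d·S̄` (`S̄ = z₁w̄₁ + z₂w̄₂`), because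
`Ḡᵀ = G` and `G·H = d·1`. [kernel, `ring`] -/
theorem cross_term {R : Type*} [CommRing R] (a e b bb A t z₁ z₂ zb₁ zb₂ wb₁ wb₂ : R) :
    (A * zb₁ + t * (e * wb₁ - bb * wb₂)) * (a * z₁ + b * z₂) + (A * zb₂ + t * (-b * wb₁ + a * wb₂)) * (bb * z₁ + e * z₂)
    = A * (zb₁ * (a * z₁ + b * z₂) + zb₂ * (bb * z₁ + e * z₂)) + t * (a * e - b * bb) * (z₁ * wb₁ + z₂ * wb₂) := by
  ring

/-- Identity (2′): the conjugate cross term `H(z, z₀) = z̄ᵀ·H·z₀ = A·H[z] + t·d·S` (`S = z̄₁w₁ + z̄₂w₂`). [kernel, `ring`] -/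
theorem cross_term' {R : Type*} [CommRing R] (a e b bb A t z₁ z₂ zb₁ zb₂ w₁ w₂ : R) :
    zb₁ * (a * (A * z₁ + t * (e * w₁ - b * w₂)) + b * (A * z₂ + t * (-bb * w₁ + a * w₂)))
      + zb₂ * (bb * (A * z₁ + t * (e * w₁ - b * w₂)) + e * (A * z₂ + t * (-bb * w₁ + a * w₂)))
    = A * (zb₁ * (a * z₁ + b * z₂) + zb₂ * (bb * z₁ + e * z₂)) + t * (a * e - b * bb) * (zb₁ * w₁ + zb₂ * w₂) := by
  ring

/-- **The binary Gram ∕ Lagrange identity** for the pair `(z, y)` (here `y` plays `z₀`; `yb` its conjugate):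
`H[z]·H[y] − H(y,z)·H(z,y) = d·(z₁y₂ − z₂y₁)·(z̄₁ȳ₂ − z̄₂ȳ₁)`. In `O_K ⊂ ℂ` the last factor pair is `|z₁y₂ − z₂y₁|² ≥ 0`,
so for `d > 0` this is Cauchy–Schwarz `|H(y,z)|² ≤ H[y]·H[z]` with its exact defect. [kernel, `ring`] -/
theorem gram_identity {R : Type*} [CommRing R] (a e b bb z₁ z₂ zb₁ zb₂ y₁ y₂ yb₁ yb₂ : R) :
    (zb₁ * (a * z₁ + b * z₂) + zb₂ * (bb * z₁ + e * z₂)) * (yb₁ * (a * y₁ + b * y₂) + yb₂ * (bb * y₁ + e * y₂))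
      - (yb₁ * (a * z₁ + b * z₂) + yb₂ * (bb * z₁ + e * z₂)) * (zb₁ * (a * y₁ + b * y₂) + zb₂ * (bb * y₁ + e * y₂))
    = (a * e - b * bb) * (z₁ * y₂ - z₂ * y₁) * (zb₁ * yb₂ - zb₂ * yb₁) := by
  ring

/-- **`Q` of a target.** If `R = A²·P + t²·d·Gw + t·A·d·T` (identity (1) by value: `R = H[z₀]`, `P = H[z]`, `Gw = G[w]`,
`T = Tr S`) and the target relation `A² + M = t·N′·d` holds, then `R + M·P = t·d·(N′·P + t·Gw + A·T)`, i.e.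
`Q := (H[z₀] + M·H[z])∕(td) = N′·H[z] + t·G[w] + A·Tr S`. [kernel] -/
theorem formQ_of_target {R' : Type*} [CommRing R'] (A M t N' d R P Gw T : R')
    (hR : R = A ^ 2 * P + t ^ 2 * d * Gw + t * A * d * T) (htarget : A ^ 2 + M = t * N' * d) :
    R + M * P = t * d * (N' * P + t * Gw + A * T) := by
  rw [hR]
  linear_combination P * htarget

/-! ## §2 The integrality step over `ℤ`: Cauchy–Schwarz + AM–GM force `q = 0` -/

/-- AM–GM in the form used: `4·M·R·P ≤ (R + M·P)²`. [kernel] -/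
theorem am_gm_target (M R P : ℤ) : 4 * M * R * P ≤ (R + M * P) ^ 2 := by
  nlinarith [sq_nonneg (R - M * P)]

/-- **Norm-one pairs have `z*w ∈ ℤ`** (card §4 (2); SEC35 §1 «`b = 0`»). Integers `M ≥ 1`, `R, P ≥ 0` (`R = H[z₀]`,
`P = H[z]`), `t·d ≠ 0`; the cross term `X = H(z₀,z) = u + vω` with `u = A·P + td·(p − q)`, `v = −td·q` (identity (2) with
`S = p + qω`); Cauchy–Schwarz BY VALUE `X X̄ = u² − uv + v² ≤ R·P`; and the norm-one equation `R + M·P = t·d`. Then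
`q = 0`. Proof: `3(tdq)² ≤ (2u − v)² + 3v² = 4·X X̄ ≤ 4RP ≤ 4MRP ≤ (R + MP)² = (td)²`, so `3q² ≤ 1`. [kernel] -/
theorem normOne_forces_q_zero (M R P A t d p q : ℤ) (hM : 1 ≤ M) (hR : 0 ≤ R) (hP : 0 ≤ P) (htd : t * d ≠ 0)
    (hCS : (A * P + t * d * (p - q)) ^ 2 - (A * P + t * d * (p - q)) * (-(t * d * q)) + (-(t * d * q)) ^ 2 ≤ R * P)
    (hone : R + M * P = t * d) : q = 0 := by
  set u : ℤ := A * P + t * d * (p - q) with hu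
  set v : ℤ := -(t * d * q) with hv
  have h1 : 3 * v ^ 2 ≤ 4 * (R * P) := by nlinarith [sq_nonneg (2 * u - v), hCS]
  have hRP : 0 ≤ R * P := mul_nonneg hR hP
  have h2 : 4 * (R * P) ≤ 4 * (M * R * P) := by nlinarith [hRP, hM]
  have h3 : 4 * (M * R * P) ≤ (t * d) ^ 2 := by
    have := am_gm_target M R P
    rw [hone] at this
    linarith
  have h4 : 3 * ((t * d) * q) ^ 2 ≤ (t * d) ^ 2 := by
    have : v ^ 2 = ((t * d) * q) ^ 2 := by rw [hv]; ring
    linarith [h1, h2, h3, this]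
  have htd2 : 0 < (t * d) ^ 2 := by positivity
  have hq2 : 3 * q ^ 2 ≤ 1 := by
    by_contra hcon
    push Not at hcon
    have : (t * d) ^ 2 * 1 < (t * d) ^ 2 * (3 * q ^ 2) := mul_lt_mul_of_pos_left hcon htd2
    nlinarith [h4, this]
  nlinarith [sq_nonneg q, hq2]

/-! ## §3 THEOREM 54 by the `δ`-free route -/

/-- The parity statement on its own: with `t`, `N′` even and `q = 0`, `Q = N′·P + t·Gw + A·(2p − q)` is even. [kernel] -/
theorem doublyEven_Q_even (t N' A P Gw p q : ℤ) (ht : Even t) (hN : Even N') (hq : q = 0) :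
    Even (N' * P + t * Gw + A * (2 * p - q)) := by
  subst hq
  obtain ⟨t₁, rfl⟩ := ht
  obtain ⟨n₁, rfl⟩ := hN
  exact ⟨n₁ * P + t₁ * Gw + A * p, by ring⟩

/-- **THEOREM 54 (doubly-even targets are never reached), `δ`-free route — kernel form.** Integers: `M ≥ 1` (`= |m|`),
`t·d ≠ 0`, the target relation `A² + M = t·N′·d` with `t` and `N′` BOTH EVEN; for a pair `(z, w)` the by-value data
`P = H[z] ≥ 0`, `R = H[z₀] ≥ 0` with identity (1) `R = A²P + t²d·Gw + tAd·(2p − q)` (`Gw = G[w]`, `S = z*w = p + qω`,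
`Tr S = 2p − q`), and Cauchy–Schwarz by value for the cross term of identity (2). Then `Q = N′·P + t·Gw + A·(2p − q) ≠ 1`:
the pair is not a norm-one pair. (If `Q = 1` then `R + MP = td` by `formQ_of_target`, so `q = 0` by
`normOne_forces_q_zero`, so `Q` is even by `doublyEven_Q_even`.) Since every lattice vector is such a pair (THEOREM 35-A′,
by value), the target is NEVER reached. [kernel] -/
theorem doublyEven_never_deltaFree (M R P Gw A t N' d p q : ℤ) (hM : 1 ≤ M) (hR : 0 ≤ R) (hP : 0 ≤ P)
    (htd : t * d ≠ 0) (htarget : A ^ 2 + M = t * N' * d) (ht : Even t) (hN : Even N')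
    (hform : R = A ^ 2 * P + t ^ 2 * d * Gw + t * A * d * (2 * p - q))
    (hCS : (A * P + t * d * (p - q)) ^ 2 - (A * P + t * d * (p - q)) * (-(t * d * q)) + (-(t * d * q)) ^ 2 ≤ R * P) :
    N' * P + t * Gw + A * (2 * p - q) ≠ 1 := by
  intro hQ
  have hsum : R + M * P = t * d * (N' * P + t * Gw + A * (2 * p - q)) :=
    formQ_of_target A M t N' d R P Gw (2 * p - q) hform htarget
  rw [hQ, mul_one] at hsum
  have hq : q = 0 := normOne_forces_q_zero M R P A t d p q hM hR hP htd hCS hsum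
  have heven : Even (N' * P + t * Gw + A * (2 * p - q)) := doublyEven_Q_even t N' A P Gw p q ht hN hq
  rw [hQ] at heven
  exact Int.not_even_one heven

/-- **The parity hypotheses are each needed** (kernel-level sharpness of `doublyEven_Q_even`; the model-level sharpness
«mixed parity IS reached» is PROBE5 §54 v6.2's data, not claimed here): with only `t` even, or only `N′` even, the value
`N′·P + t·Gw + A·(2p)` can be odd — witnesses `(t, N′, P, Gw, A, p) = (2, 1, 1, 0, 0, 0)` and `(1, 2, 0, 1, 0, 0)`. [kernel] -/
theorem parity_hypotheses_needed :
    (∃ t N' P Gw A p : ℤ, Even t ∧ ¬ Even (N' * P + t * Gw + A * (2 * p))) ∧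
      (∃ t N' P Gw A p : ℤ, Even N' ∧ ¬ Even (N' * P + t * Gw + A * (2 * p))) := by
  refine ⟨⟨2, 1, 1, 0, 0, 0, ⟨1, rfl⟩, by decide⟩, ⟨1, 2, 0, 1, 0, 0, ⟨1, rfl⟩, by decide⟩⟩

end Summit.Ventures.HSemireg.PairBlockDeltaFree
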